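/-
Copyright (c) 2026. Released under the Apache 2.0 license.
-/
import Literature.NumberTheory.EllipticCurves.ManinConstantPotMultiplicativeProofs
import Literature.NumberTheory.EllipticCurves.FormalMulThreeHeightDichotomyProofs
import Literature.NumberTheory.EllipticCurves.LegendreFormValuation
import HarnessLib

/-!
# The Legendre twist at an odd additive prime, `‖q‖₃ ≤ 1`, and Edixhoven's integrality away
# from an additive prime `2`

[Proofs] Theorems only (no definition, no named fact). This file completes the prime `3` in the
local programme of the fact
`Literature.NumberTheory.EllipticCurves.edixhoven_int_of_neronLattice_eq_smul_periodLattice`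
(`NeronIsogenyScaling.lean`; Edixhoven 1991, Prop. 2: the Néron–period scaling `q` of a globally
minimal `W'/ℚ` with a newform is an integer) and reduces the whole fact to its local statement at
an additive prime `2`:

* `legendre_smul_eq` — over any field with `2 ≠ 0`: if `4x³ + b₂x² + 2b₄x + b₆ =
  4(x − e₁)(x − e₂)(x − e₃)` (Vieta) and `u² = e₂ − e₁ ≠ 0`, then
  `(u, e₁, −a₁/2, −(a₃ + e₁a₁)/2) • W = (y² = x(x − 1)(x − λ))`, `λ = (e₃ − e₁)/(e₂ − e₁)`
  (Silverman III.1.7); with the tree's `legendre_c₄ = 16(λ² − λ + 1)`, `legendre_Δ = 16λ²(λ − 1)²`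
  (`LegendreFormValuation`).
* `norm_le_one_of_twoTorsion_cubic_root` (roots of `4x³ + Bx² + Cx + D`, `‖4‖ = 1`, integral coefficients,
  are integral) and `norm_eq_one_and_norm_sub_one_eq_one` (`‖λ² − λ + 1‖³ ≤ ‖λ‖²‖λ − 1‖²` forces
  `‖λ‖ = ‖λ − 1‖ = 1`: Silverman VII.5.4(c)), over any ultrametric normed field.
* `exists_legendreTwist_of_norm_j_le_one` — THE GOOD TWIST at an odd prime `p` with `‖j‖_p ≤ 1`:
  over `K = ℚ_p(e₁, e₂, e₃, √(e₂ − e₁))` (roots of the `2`-division cubic, Mathlib's `Cubic`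
  Vieta API), with `O = 𝒪_K`, a uniformiser `π` (`‖π‖ᵉ = p⁻¹`) and the unit part `w` of
  `√(e₂ − e₁) = wπᵏ`, the `O`-curve `V'' = (w⁻¹, 0, 0, 0) • Legendre =
  (0, −(1 + λ)w², 0, λw⁴, 0)` has `Δ(V'') = 16λ²(λ − 1)²w¹² ∈ O^×` (good reduction),
  `V'' ⊗ K = (πᵏ, e₁, −a₁/2, −(a₃ + e₁a₁)/2) • (W' ⊗ K)` with `e₁, −a₁/2, … ∈ O`, and
  `12k = e·v_p(Δ_min)`.
* `padicNorm_le_one_of_neronLattice_eq_smul_periodLattice_of_norm_j_le_one_three` — at an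
  additive `3` with `‖j‖₃ ≤ 1`: Kraus (`not_pow_dvd_c₄_minimalDiscriminantInt_three`) gives
  `v₃(Δ_min) ≤ 13`, so `8k < 9e`, and the good-twist ender `…_of_goodTwist_three`
  (`FormalMulThreeHeightDichotomyProofs`) applies; with the potentially multiplicative case
  (`…_of_one_lt_norm_j_three`, `ManinConstantPotMultiplicativeProofs`):
  `…_of_additive_three` and **`padicNorm_three_le_one_of_neronLattice_eq_smul_periodLattice`:
  `‖q‖₃ ≤ 1` for every datum of the fact.**
* `int_of_neronLattice_eq_smul_periodLattice_of_not_additive_two` — **`q ∈ ℤ` for every `W'`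
  whose reduction at `2` is not additive** (`v₂(N) ≤ 1`), and
  `edixhoven_int_of_neronLattice_eq_smul_periodLattice_of_additive_two` — **the fact follows
  from its local statement `‖q‖₂ ≤ 1` at an additive prime `2`** (the only remaining case:
  potentially good additive reduction at `2`, cf. the fact's docstring).

## References
* [EdixhovenManin1991] B. Edixhoven, *On the Manin constants of modular elliptic curves*,
  in: Arithmetic algebraic geometry (Texel, 1989), Progr. Math. 89 (1991), 25–39, Prop. 2.
* [SilvermanAEC2009] J. H. Silverman, *The Arithmetic of Elliptic Curves*, 2nd ed., GTM 106
  (2009): Prop. III.1.7 (Legendre form), VII.5.4 (proof of (c): `λ, 1 − λ` units when `j` is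
  integral), VII.5.5, Exercise 7.1 (Kraus).
* [Kraus1989] A. Kraus, *Quelques remarques à propos des invariants `c₄`, `c₆` et `Δ` d'une
  courbe elliptique*, Acta Arith. 54 (1989), 75–80.
-/

noncomputable section

open scoped Classical

namespace Literature.NumberTheory.EllipticCurves

open _root_.WeierstrassCurve

/-! ### The Legendre change of variables (pure algebra over a field with `2 ≠ 0`) -/

section Legendre

variable {F : Type*} [Field F]

/-- **The Legendre form.** If `4x³ + b₂x² + 2b₄x + b₆ = 4(x − e₁)(x − e₂)(x − e₃)` (Vieta) and
`u² = e₂ − e₁ ≠ 0`, then `(u, e₁, −a₁/2, −(a₃ + e₁a₁)/2) • W = y² = x(x − 1)(x − λ)`,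
`λ = (e₃ − e₁)/(e₂ − e₁)`. [cite: SilvermanAEC2009, Prop. III.1.7] -/
theorem legendre_smul_eq (h2 : (2 : F) ≠ 0) (W : WeierstrassCurve F) {e₁ e₂ e₃ u : F}
    (hσ₁ : W.a₁ ^ 2 + 4 * W.a₂ = -4 * (e₁ + e₂ + e₃))
    (hσ₂ : 2 * W.a₄ + W.a₁ * W.a₃ = 2 * (e₁ * e₂ + e₁ * e₃ + e₂ * e₃))
    (hσ₃ : W.a₃ ^ 2 + 4 * W.a₆ = -4 * (e₁ * e₂ * e₃))
    (hu : u ≠ 0) (hu2 : u ^ 2 = e₂ - e₁) :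
    (⟨Units.mk0 u hu, e₁, -W.a₁ / 2, -(W.a₃ + e₁ * W.a₁) / 2⟩ : VariableChange F) • W =
      ⟨0, -(1 + (e₃ - e₁) / (e₂ - e₁)), 0, (e₃ - e₁) / (e₂ - e₁), 0⟩ := by
  have he₂ : e₂ = u ^ 2 + e₁ := by rw [hu2]; ring
  subst he₂
  have he : u ^ 2 + e₁ - e₁ = u ^ 2 := by ring
  ext
  · rw [variableChange_a₁]
    simp only [Units.val_inv_eq_inv_val, Units.val_mk0]
    field_simp
    ring
  · rw [variableChange_a₂]
    simp only [Units.val_inv_eq_inv_val, Units.val_mk0, he]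
    field_simp
    linear_combination hσ₁
  · rw [variableChange_a₃]
    simp only [Units.val_inv_eq_inv_val, Units.val_mk0]
    field_simp
    ring
  · rw [variableChange_a₄]
    simp only [Units.val_inv_eq_inv_val, Units.val_mk0, he]
    field_simp
    linear_combination hσ₂ + e₁ * hσ₁
  · rw [variableChange_a₆]
    simp only [Units.val_inv_eq_inv_val, Units.val_mk0]
    field_simp
    linear_combination hσ₃ + e₁ * (2 * hσ₂) + e₁ ^ 2 * hσ₁

end Legendre

/-! ### Ultrametric lemmas: integrality of the `2`-division roots, units `λ, 1 − λ` -/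

section Ultra

variable {F : Type*} [NormedField F] [IsUltrametricDist F]

/-- `‖a − b‖ ≤ max ‖a‖ ‖b‖` — a duplicate of `norm_sub_le_max_of_isUltrametricDist`
(`SelmerInertiaProofs`, any ultrametric seminormed group), kept as a deprecated alias. [folklore] -/
@[deprecated norm_sub_le_max_of_isUltrametricDist (since := "2026-08-17")]
alias norm_sub_le_max₃ := norm_sub_le_max_of_isUltrametricDist

/-- A root of `4x³ + Bx² + Cx + D` with `‖4‖ = 1` and `‖B‖, ‖C‖, ‖D‖ ≤ 1` has norm `≤ 1`.
[folklore] -/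
theorem norm_le_one_of_twoTorsion_cubic_root {B C D e : F} (h4 : ‖(4 : F)‖ = 1) (hB : ‖B‖ ≤ 1)
    (hC : ‖C‖ ≤ 1) (hD : ‖D‖ ≤ 1) (he : 4 * e ^ 3 + B * e ^ 2 + C * e + D = 0) : ‖e‖ ≤ 1 := by
  by_contra hcon
  rw [not_le] at hcon
  have he1 : 1 ≤ ‖e‖ := hcon.le
  have hlow : ‖B * e ^ 2 + C * e + D‖ ≤ ‖e‖ ^ 2 := by
    refine (IsUltrametricDist.norm_add_le_max _ _).trans (max_le ?_ (hD.trans (one_le_pow₀ he1)))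
    refine (IsUltrametricDist.norm_add_le_max _ _).trans (max_le ?_ ?_)
    · rw [norm_mul, norm_pow]; exact mul_le_of_le_one_left (by positivity) hB
    · rw [norm_mul]
      calc ‖C‖ * ‖e‖ ≤ 1 * ‖e‖ := by gcongr
        _ = ‖e‖ ^ 1 := by ring
        _ ≤ ‖e‖ ^ 2 := pow_le_pow_right₀ he1 (by norm_num)
  have hmain : ‖(4 : F) * e ^ 3‖ = ‖e‖ ^ 3 := by rw [norm_mul, norm_pow, h4, one_mul]
  have hlt : ‖(4 * e ^ 3 + (B * e ^ 2 + C * e + D)) - 4 * e ^ 3‖ < ‖(4 : F) * e ^ 3‖ := by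
    rw [add_sub_cancel_left, hmain]
    exact hlow.trans_lt (pow_lt_pow_right₀ hcon (by norm_num))
  have h := norm_eq_of_norm_sub_lt' hlt
  rw [show (4 : F) * e ^ 3 + (B * e ^ 2 + C * e + D) = 0 by rw [← he]; ring, norm_zero, hmain] at h
  exact absurd h.symm (pow_ne_zero 3 (one_pos.trans hcon).ne')

/-- **`λ, 1 − λ` are units when `‖j‖ ≤ 1`:** if `‖λ² − λ + 1‖³ ≤ ‖λ‖²·‖λ − 1‖²` (i.e.
`‖j(y² = x(x−1)(x−λ))‖ = ‖2⁸(λ²−λ+1)³/(λ²(λ−1)²)‖ ≤ 1` at odd residue characteristic) then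
`‖λ‖ = 1` and `‖λ − 1‖ = 1`. [cite: SilvermanAEC2009, VII.5.4, proof of (c)] -/
theorem norm_eq_one_and_norm_sub_one_eq_one {l : F}
    (h : ‖l ^ 2 - l + 1‖ ^ 3 ≤ ‖l‖ ^ 2 * ‖l - 1‖ ^ 2) : ‖l‖ = 1 ∧ ‖l - 1‖ = 1 := by
  have hl1 : ‖l - 1‖ ≤ max ‖l‖ 1 := by
    rw [sub_eq_add_neg]
    exact (IsUltrametricDist.norm_add_le_max _ _).trans (by rw [norm_neg, norm_one])
  rcases lt_trichotomy ‖l‖ 1 with hlt | heq | hgt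
  · -- ‖λ‖ < 1: ‖λ² − λ + 1‖ = 1
    exfalso
    have hq : ‖l ^ 2 - l + 1‖ = 1 := by
      rw [← norm_one (α := F)]
      refine norm_eq_of_norm_sub_lt' ?_
      rw [add_sub_cancel_right, norm_one]
      refine (norm_sub_le_max_of_isUltrametricDist _ _).trans_lt (max_lt ?_ hlt)
      rw [norm_pow]; exact pow_lt_one₀ (norm_nonneg _) hlt two_ne_zero
    rw [hq, one_pow] at h
    have h1 : ‖l - 1‖ ≤ 1 := hl1.trans (max_le hlt.le le_rfl)
    have : ‖l‖ ^ 2 * ‖l - 1‖ ^ 2 < 1 := by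
      calc ‖l‖ ^ 2 * ‖l - 1‖ ^ 2 ≤ ‖l‖ ^ 2 * 1 := by
            gcongr; exact pow_le_one₀ (norm_nonneg _) h1
        _ < 1 := by rw [mul_one]; exact pow_lt_one₀ (norm_nonneg _) hlt two_ne_zero
    linarith
  · refine ⟨heq, le_antisymm (hl1.trans (max_le heq.le le_rfl)) ?_⟩
    by_contra hcon
    rw [not_le] at hcon
    -- ‖λ‖ = 1, ‖λ − 1‖ < 1: ‖λ² − λ + 1‖ = ‖λ(λ−1) + 1‖ = 1
    have hq : ‖l ^ 2 - l + 1‖ = 1 := by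
      rw [← norm_one (α := F)]
      refine norm_eq_of_norm_sub_lt' ?_
      rw [add_sub_cancel_right, norm_one, show l ^ 2 - l = l * (l - 1) by ring, norm_mul, heq, one_mul]
      exact hcon
    rw [hq, one_pow, heq, one_pow, one_mul] at h
    have : ‖l - 1‖ ^ 2 < 1 := pow_lt_one₀ (norm_nonneg _) hcon two_ne_zero
    linarith
  · -- ‖λ‖ > 1: ‖λ² − λ + 1‖ = ‖λ‖²
    exfalso
    have hl1' : ‖l - 1‖ = ‖l‖ :=
      norm_eq_of_norm_sub_lt' (by rw [sub_sub_cancel_left, norm_neg, norm_one]; exact hgt)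
    have hq : ‖l ^ 2 - l + 1‖ = ‖l‖ ^ 2 := by
      rw [← norm_pow]
      refine norm_eq_of_norm_sub_lt' ?_
      rw [show l ^ 2 - l + 1 - l ^ 2 = 1 - l by ring, norm_pow, ← neg_sub, norm_neg, hl1']
      exact lt_self_pow₀ hgt (by norm_num)
    rw [hq, hl1', ← pow_mul, ← pow_add] at h
    have : ‖l‖ ^ (2 + 2) < ‖l‖ ^ (2 * 3) := pow_lt_pow_right₀ hgt (by norm_num)
    linarith

end Ultra


/-! ### The Legendre twist at an odd prime of potentially good reduction -/

section Twist

open scoped IntermediateField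
open Literature.NumberTheory.GaloisRepresentations IsLocalRing
open Literature.NumberTheory.EllipticCurves.ModularForms Literature.NumberTheory.Automorphic
open scoped MatrixGroups ModularForm
open CongruenceSubgroup PowerSeries

/-- `j·Δ = c₄³` — a restatement (over fields) of `WeierstrassCurve.j_mul_Δ_eq_c₄_pow`
(`InertiaInvariantsMultiplicativeProofs.lean`, any commutative ring); kept as a deprecated alias
(dedup-02761). [folklore] -/
@[deprecated WeierstrassCurve.j_mul_Δ_eq_c₄_pow (since := "2026-08-17")]
theorem j_mul_Δ_eq {F : Type*} [Field F] (E : WeierstrassCurve F) [E.IsElliptic] :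
    E.j * E.Δ = E.c₄ ^ 3 :=
  WeierstrassCurve.j_mul_Δ_eq_c₄_pow E

set_option maxHeartbeats 4000000 in
/-- **The Legendre twist at an odd prime `p` with `‖j‖_p ≤ 1`.** Let `W'/ℚ` be globally minimal,
`p` odd, `‖j(W')‖_p ≤ 1` and `‖Δ(W')‖_p = p⁻ᵛ`. Over `K = ℚ_p(e₁, e₂, e₃, √(e₂ − e₁))` (`eᵢ` the
roots of `4x³ + b₂x² + 2b₄x + b₆`), with ring of integers `O` and a uniformiser `π`
(`‖π‖ᵉ = p⁻¹`): there are `r, s, t ∈ O` and an `O`-curve `V''` with GOOD reduction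
(`Δ(V'') ∈ O^×`), `V'' ⊗ K = (πᵏ, r, s, t) • (W' ⊗ K)` and `12k = ve`. Construction:
`D = (√(e₂ − e₁), e₁, −a₁/2, −(a₃ + e₁a₁)/2)` carries `W' ⊗ K` to the Legendre form
`y² = x(x − 1)(x − λ)`, `λ = (e₃ − e₁)/(e₂ − e₁)` (`legendre_smul_eq`), `λ, 1 − λ ∈ O^×` because
`‖j‖ ≤ 1` (`norm_eq_one_and_norm_sub_one_eq_one`), and `V'' = (w⁻¹, 0, 0, 0) • Legendre` for the
unit part `w` of `√(e₂ − e₁) = wπᵏ`. [cite: SilvermanAEC2009, Prop. III.1.7, VII.5.4(c), VII.5.5] -/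
theorem exists_legendreTwist_of_norm_j_le_one {p : ℕ} [hp : Fact p.Prime] (hp2 : p ≠ 2)
    (W' : WeierstrassCurve ℚ) [W'.IsElliptic] [W'.IsGloballyMinimal]
    (hj : ‖((W'.j : ℚ) : ℚ_[p])‖ ≤ 1) {v : ℕ} (hv : ‖((W'.Δ : ℚ) : ℚ_[p])‖ = ((p : ℝ)⁻¹) ^ v) :
    ∃ (K : IntermediateField ℚ_[p] (PadicAlgCl p)) (_ : FiniteDimensional ℚ_[p] K) (πu : Kˣ)
      (e k : ℕ) (r s t : padicCoeffRing K) (V'' : WeierstrassCurve (padicCoeffRing K)),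
      ‖((πu : K) : PadicAlgCl p)‖ ^ e = (p : ℝ)⁻¹ ∧ 0 < e ∧ 12 * k = v * e ∧
      V''.map (algebraMap (padicCoeffRing K) K) =
        (⟨πu ^ k, (r : K), (s : K), (t : K)⟩ : VariableChange K) • W'.map (algebraMap ℚ K) ∧
      IsUnit V''.Δ := by
  classical
  have hp1R : (1 : ℝ) < p := by exact_mod_cast hp.out.one_lt
  have hp0R : (0 : ℝ) < p := by positivity
  have hΔ0 : W'.Δ ≠ 0 := W'.isUnit_Δ.ne_zero
  /- Step 1: the `2`-division cubic and its roots in `ℚ̄_p`. -/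
  set P : Cubic ℚ := W'.twoTorsionPolynomial with hP
  have hPa : P.a = 4 := rfl
  have hPa0 : P.a ≠ 0 := by rw [hPa]; norm_num
  set φA : ℚ →+* PadicAlgCl p := algebraMap ℚ (PadicAlgCl p) with hφA
  obtain ⟨e₁, e₂, e₃, h3⟩ :=
    (Cubic.splits_iff_roots_eq_three hPa0 (φ := φA)).mp (IsAlgClosed.splits _)
  have h4φ : φA P.a = 4 := by rw [hPa, map_ofNat]
  have hσ₁A : φA W'.a₁ ^ 2 + 4 * φA W'.a₂ = -4 * (e₁ + e₂ + e₃) := by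
    have h := Cubic.b_eq_three_roots hPa0 h3
    rw [h4φ] at h
    change φA W'.b₂ = _ at h
    rw [WeierstrassCurve.b₂, map_add, map_pow, map_mul, map_ofNat] at h
    linear_combination h
  have hσ₂A : 2 * φA W'.a₄ + φA W'.a₁ * φA W'.a₃ = 2 * (e₁ * e₂ + e₁ * e₃ + e₂ * e₃) := by
    have h := Cubic.c_eq_three_roots hPa0 h3
    rw [h4φ] at h
    change φA (2 * W'.b₄) = _ at h
    rw [WeierstrassCurve.b₄, map_mul, map_add, map_mul, map_mul, map_ofNat] at h
    linear_combination (1 / 2 : PadicAlgCl p) * h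
  have hσ₃A : φA W'.a₃ ^ 2 + 4 * φA W'.a₆ = -4 * (e₁ * e₂ * e₃) := by
    have h := Cubic.d_eq_three_roots hPa0 h3
    rw [h4φ] at h
    change φA W'.b₆ = _ at h
    rw [WeierstrassCurve.b₆, map_add, map_pow, map_mul, map_ofNat] at h
    linear_combination h
  have hdisc : φA (16 * W'.Δ) = (4 * 4 * (e₁ - e₂) * (e₁ - e₃) * (e₂ - e₃)) ^ 2 := by
    have h := Cubic.discr_eq_prod_three_roots hPa0 h3
    rw [h4φ] at h
    rw [← h, WeierstrassCurve.twoTorsionPolynomial_discr]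
  have h12 : e₂ - e₁ ≠ 0 := by
    intro h
    apply mul_ne_zero (by norm_num : (16 : ℚ) ≠ 0) hΔ0
    apply (map_eq_zero φA).mp
    rw [hdisc, show e₁ - e₂ = -(e₂ - e₁) by ring, h]
    ring
  -- the root equations
  have hroot : ∀ e ∈ ({e₁, e₂, e₃} : Multiset (PadicAlgCl p)),
      4 * e ^ 3 + φA W'.b₂ * e ^ 2 + φA (2 * W'.b₄) * e + φA W'.b₆ = 0 := by
    intro e he
    rw [← h3, Cubic.mem_roots_iff (Cubic.ne_zero_of_a_ne_zero (by
      change φA P.a ≠ 0; rw [hPa, map_ofNat]; norm_num))] at he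
    change φA P.a * e ^ 3 + φA P.b * e ^ 2 + φA P.c * e + φA P.d = 0 at he
    rw [hPa, map_ofNat] at he
    exact he
  /- Step 2: `u₀² = e₂ − e₁` and the field `K = ℚ_p(e₁, e₂, e₃, u₀)`. -/
  obtain ⟨u₀, hu₀⟩ := IsAlgClosed.exists_pow_nat_eq (e₂ - e₁) two_pos
  have hu₀0 : u₀ ≠ 0 := by
    intro h
    rw [h, zero_pow two_ne_zero] at hu₀
    exact h12 hu₀.symm
  set φ : ℚ →+* ℚ_[p] := algebraMap ℚ ℚ_[p] with hφ
  have hφA' : ∀ a : ℚ, φA a = algebraMap ℚ_[p] (PadicAlgCl p) (a : ℚ_[p]) := fun a ↦ by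
    rw [hφA, eq_ratCast, map_ratCast]
  have halg : ∀ e : PadicAlgCl p,
      4 * e ^ 3 + φA W'.b₂ * e ^ 2 + φA (2 * W'.b₄) * e + φA W'.b₆ = 0 → IsIntegral ℚ_[p] e := by
    intro e he
    refine IsAlgebraic.isIntegral ⟨Polynomial.C 4 * Polynomial.X ^ 3 +
      Polynomial.C ((W'.b₂ : ℚ) : ℚ_[p]) * Polynomial.X ^ 2 +
      Polynomial.C ((2 * W'.b₄ : ℚ) : ℚ_[p]) * Polynomial.X + Polynomial.C ((W'.b₆ : ℚ) : ℚ_[p]),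
      fun h0 ↦ ?_, ?_⟩
    · have := congrArg (Polynomial.coeff · 3) h0
      simp at this
    · simp only [map_add, map_mul, Polynomial.aeval_C, Polynomial.aeval_X_pow, Polynomial.aeval_X,
        map_ofNat]
      rw [← hφA', ← hφA', ← hφA']
      exact he
  have he₁i : IsIntegral ℚ_[p] e₁ := halg e₁ (hroot e₁ (by simp))
  have he₂i : IsIntegral ℚ_[p] e₂ := halg e₂ (hroot e₂ (by simp))
  have he₃i : IsIntegral ℚ_[p] e₃ := halg e₃ (hroot e₃ (by simp))
  have hu₀i : IsIntegral ℚ_[p] u₀ := IsIntegral.of_pow two_pos (by rw [hu₀]; exact he₂i.sub he₁i)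
  set Sgen : Set (PadicAlgCl p) := {e₁, e₂, e₃, u₀} with hSgen
  set K : IntermediateField ℚ_[p] (PadicAlgCl p) := IntermediateField.adjoin ℚ_[p] Sgen with hKdef
  haveI hKfd : FiniteDimensional ℚ_[p] K := by
    refine IntermediateField.finiteDimensional_adjoin fun x hx ↦ ?_
    rcases hx with rfl | rfl | rfl | rfl
    exacts [he₁i, he₂i, he₃i, hu₀i]
  set φK : ℚ_[p] →+* K := algebraMap ℚ_[p] K with hφK
  set φQ : ℚ →+* K := algebraMap ℚ K with hφQ
  have hcomp : φK.comp φ = φQ := RingHom.ext fun x ↦ by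
    rw [eq_ratCast (φK.comp φ) x, eq_ratCast φQ x]
  have hφQ' : ∀ x : ℚ, φQ x = φK (x : ℚ_[p]) := fun x ↦ by
    rw [← hcomp, RingHom.comp_apply, hφ, eq_ratCast]
  have hnormQ : ∀ x : ℚ, ‖((φQ x : K) : PadicAlgCl p)‖ = ‖(x : ℚ_[p])‖ := fun x ↦ by
    rw [hφQ', hφK, IntermediateField.coe_algebraMap_apply, PadicAlgCl.norm_extends]
  have hQA : ∀ a : ℚ, ((φQ a : K) : PadicAlgCl p) = φA a := fun a ↦ by
    rw [hφQ', hφK, IntermediateField.coe_algebraMap_apply, hφA']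
  have hmem : ∀ x ∈ Sgen, x ∈ K := fun x hx ↦ IntermediateField.subset_adjoin ℚ_[p] Sgen hx
  set e₁K : K := ⟨e₁, hmem e₁ (by simp [hSgen])⟩ with he₁K
  set e₂K : K := ⟨e₂, hmem e₂ (by simp [hSgen])⟩ with he₂K
  set e₃K : K := ⟨e₃, hmem e₃ (by simp [hSgen])⟩ with he₃K
  set u' : K := ⟨u₀, hmem u₀ (by simp [hSgen])⟩ with hu'
  have hu'2 : u' ^ 2 = e₂K - e₁K := Subtype.ext (by push_cast; exact hu₀)
  have hu'0 : u' ≠ 0 := fun h ↦ hu₀0 (congrArg Subtype.val h)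
  have h2K : (2 : K) ≠ 0 := two_ne_zero
  /- Step 3: Vieta in `K` and the Legendre change of variables. -/
  set W'K : WeierstrassCurve K := W'.map φQ with hW'K
  have hK4 : ((4 : K) : PadicAlgCl p) = 4 := by
    rw [← map_ofNat φQ 4, hQA, map_ofNat]
  have hK2 : ((2 : K) : PadicAlgCl p) = 2 := by
    rw [← map_ofNat φQ 2, hQA, map_ofNat]
  have hσ₁K : W'K.a₁ ^ 2 + 4 * W'K.a₂ = -4 * (e₁K + e₂K + e₃K) := by
    apply Subtype.ext
    change (((φQ W'.a₁ ^ 2 + 4 * φQ W'.a₂ : K)) : PadicAlgCl p) = ((-4 * (e₁K + e₂K + e₃K) : K) : PadicAlgCl p)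
    have e1 : (((φQ W'.a₁ ^ 2 + 4 * φQ W'.a₂ : K)) : PadicAlgCl p) =
        ((φQ W'.a₁ : K) : PadicAlgCl p) ^ 2 + ((4 : K) : PadicAlgCl p) * ((φQ W'.a₂ : K) : PadicAlgCl p) := by
      push_cast; ring
    have e2 : ((-4 * (e₁K + e₂K + e₃K) : K) : PadicAlgCl p) = -((4 : K) : PadicAlgCl p) * (e₁ + e₂ + e₃) := by
      push_cast; ring
    rw [e1, e2, hK4, hQA, hQA]
    linear_combination hσ₁A
  have hσ₂K : 2 * W'K.a₄ + W'K.a₁ * W'K.a₃ = 2 * (e₁K * e₂K + e₁K * e₃K + e₂K * e₃K) := by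
    apply Subtype.ext
    change (((2 * φQ W'.a₄ + φQ W'.a₁ * φQ W'.a₃ : K)) : PadicAlgCl p) =
      ((2 * (e₁K * e₂K + e₁K * e₃K + e₂K * e₃K) : K) : PadicAlgCl p)
    have e1 : (((2 * φQ W'.a₄ + φQ W'.a₁ * φQ W'.a₃ : K)) : PadicAlgCl p) =
        ((2 : K) : PadicAlgCl p) * ((φQ W'.a₄ : K) : PadicAlgCl p) +
          ((φQ W'.a₁ : K) : PadicAlgCl p) * ((φQ W'.a₃ : K) : PadicAlgCl p) := by
      push_cast; ring
    have e2 : ((2 * (e₁K * e₂K + e₁K * e₃K + e₂K * e₃K) : K) : PadicAlgCl p) =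
        ((2 : K) : PadicAlgCl p) * (e₁ * e₂ + e₁ * e₃ + e₂ * e₃) := by
      push_cast; ring
    rw [e1, e2, hK2, hQA, hQA, hQA]
    linear_combination hσ₂A
  have hσ₃K : W'K.a₃ ^ 2 + 4 * W'K.a₆ = -4 * (e₁K * e₂K * e₃K) := by
    apply Subtype.ext
    change (((φQ W'.a₃ ^ 2 + 4 * φQ W'.a₆ : K)) : PadicAlgCl p) = ((-4 * (e₁K * e₂K * e₃K) : K) : PadicAlgCl p)
    have e1 : (((φQ W'.a₃ ^ 2 + 4 * φQ W'.a₆ : K)) : PadicAlgCl p) =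
        ((φQ W'.a₃ : K) : PadicAlgCl p) ^ 2 + ((4 : K) : PadicAlgCl p) * ((φQ W'.a₆ : K) : PadicAlgCl p) := by
      push_cast; ring
    have e2 : ((-4 * (e₁K * e₂K * e₃K) : K) : PadicAlgCl p) = -((4 : K) : PadicAlgCl p) * (e₁ * e₂ * e₃) := by
      push_cast; ring
    rw [e1, e2, hK4, hQA, hQA]
    linear_combination hσ₃A
  set lam : K := (e₃K - e₁K) / (e₂K - e₁K) with hlam
  set L : WeierstrassCurve K := ⟨0, -(1 + lam), 0, lam, 0⟩ with hL
  set D : VariableChange K := ⟨Units.mk0 u' hu'0, e₁K, -W'K.a₁ / 2, -(W'K.a₃ + e₁K * W'K.a₁) / 2⟩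
    with hDdef
  have hD : D • W'K = L := legendre_smul_eq h2K W'K hσ₁K hσ₂K hσ₃K hu'0 hu'2
  /- Step 4: `λ, 1 − λ` are units (`‖j‖ ≤ 1`). -/
  have hp2A : ‖(2 : PadicAlgCl p)‖ = 1 := by
    rw [← map_ofNat (algebraMap ℚ_[p] (PadicAlgCl p)) 2]
    change ‖((2 : ℚ_[p]) : PadicAlgCl p)‖ = 1
    rw [PadicAlgCl.norm_extends, show (2 : ℚ_[p]) = ((2 : ℕ) : ℚ_[p]) by norm_num,
      Padic.norm_natCast_eq_one_iff]
    exact (Nat.coprime_primes hp.out Nat.prime_two).mpr hp2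
  have h16A : ‖(16 : PadicAlgCl p)‖ = 1 := by
    rw [show (16 : PadicAlgCl p) = 2 ^ 4 by norm_num, norm_pow, hp2A, one_pow]
  have h4A : ‖(4 : PadicAlgCl p)‖ = 1 := by
    rw [show (4 : PadicAlgCl p) = 2 ^ 2 by norm_num, norm_pow, hp2A, one_pow]
  have h16Q : ‖((16 : ℚ) : ℚ_[p])‖ = 1 := by
    rw [show ((16 : ℚ) : ℚ_[p]) = ((2 ^ 4 : ℕ) : ℚ_[p]) by norm_num, Padic.norm_natCast_eq_one_iff]
    exact ((Nat.coprime_primes hp.out Nat.prime_two).mpr hp2).pow_right 4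
  have hlamA : ‖((lam : K) : PadicAlgCl p)‖ = 1 ∧ ‖((lam : K) : PadicAlgCl p) - 1‖ = 1 := by
    have hjL : (D • W'K).j * (D • W'K).Δ = (D • W'K).c₄ ^ 3 :=
      WeierstrassCurve.j_mul_Δ_eq_c₄_pow _
    have hjK : (D • W'K).j = φQ W'.j := by
      rw [WeierstrassCurve.variableChange_j]; exact W'.map_j φQ
    have hΔL : (D • W'K).Δ = φQ 16 * lam ^ 2 * (lam - 1) ^ 2 := by
      rw [hD, hL, map_ofNat]; exact legendre_Δ lam
    have hc₄L : (D • W'K).c₄ = φQ 16 * (lam ^ 2 - lam + 1) := by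
      rw [hD, hL, map_ofNat]; exact legendre_c₄ lam
    rw [hjK, hΔL, hc₄L] at hjL
    -- norms in `ℚ̄_p`
    have hn : ‖((φQ W'.j * (φQ 16 * lam ^ 2 * (lam - 1) ^ 2) : K) : PadicAlgCl p)‖ =
        ‖(((φQ 16 * (lam ^ 2 - lam + 1)) ^ 3 : K) : PadicAlgCl p)‖ := by rw [hjL]
    have e1 : ((φQ W'.j * (φQ 16 * lam ^ 2 * (lam - 1) ^ 2) : K) : PadicAlgCl p) =
        ((φQ W'.j : K) : PadicAlgCl p) * ((φQ 16 : K) : PadicAlgCl p) *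
          (((lam : K) : PadicAlgCl p) ^ 2 * (((lam : K) : PadicAlgCl p) - 1) ^ 2) := by
      push_cast; ring
    have e2 : (((φQ 16 * (lam ^ 2 - lam + 1)) ^ 3 : K) : PadicAlgCl p) =
        ((φQ 16 : K) : PadicAlgCl p) ^ 3 *
          (((lam : K) : PadicAlgCl p) ^ 2 - ((lam : K) : PadicAlgCl p) + 1) ^ 3 := by
      push_cast; ring
    rw [e1, e2] at hn
    simp only [norm_mul, norm_pow] at hn
    rw [hnormQ, hnormQ, h16Q] at hn
    simp only [mul_one, one_pow, one_mul] at hn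
    refine norm_eq_one_and_norm_sub_one_eq_one ?_
    rw [← hn]
    exact mul_le_of_le_one_left (by positivity) hj
  obtain ⟨hlam1, hlam1'⟩ := hlamA
  /- Step 5: `O`, a uniformiser, `p ~ ϖᵉ`; `u₀ = wϖᵏ`. -/
  letI hOloc : IsLocalRing (padicCoeffRing K) := isLocalRing_padicCoeffRing K
  haveI hOdvr : IsDiscreteValuationRing (padicCoeffRing K) :=
    isDiscreteValuationRing_padicCoeffRing K
  obtain ⟨ϖ, hϖ⟩ := IsDiscreteValuationRing.exists_irreducible (padicCoeffRing K)
  have hϖ0 : ((ϖ : padicCoeffRing K) : K) ≠ 0 := fun h ↦ hϖ.ne_zero (Subtype.ext h)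
  have hϖA0 : (((ϖ : padicCoeffRing K) : K) : PadicAlgCl p) ≠ 0 := fun h ↦ hϖ0 (by exact_mod_cast h)
  have hϖlt : ‖(((ϖ : padicCoeffRing K) : K) : PadicAlgCl p)‖ < 1 :=
    (mem_nonunits_padicCoeffRing_iff K ϖ).mp (mem_nonunits_iff.mpr hϖ.not_isUnit)
  have hϖpos : 0 < ‖(((ϖ : padicCoeffRing K) : K) : PadicAlgCl p)‖ := norm_pos_iff.mpr hϖA0
  have hpA : ‖((p : ℕ) : PadicAlgCl p)‖ = (p : ℝ)⁻¹ := by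
    rw [← map_natCast (algebraMap ℚ_[p] (PadicAlgCl p)) p]
    change ‖((p : ℚ_[p]) : PadicAlgCl p)‖ = (p : ℝ)⁻¹
    rw [PadicAlgCl.norm_extends, Padic.norm_p]
  have hpO0 : ((p : ℕ) : padicCoeffRing K) ≠ 0 := by
    intro h
    have h1 : ‖((((p : ℕ) : padicCoeffRing K) : K) : PadicAlgCl p)‖ = 0 := by rw [h]; simp
    push_cast at h1
    rw [hpA] at h1
    exact (inv_ne_zero hp0R.ne') h1
  obtain ⟨e, vu, hpe⟩ := IsDiscreteValuationRing.eq_unit_mul_pow_irreducible hpO0 hϖ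
  have hπe : ‖(((ϖ : padicCoeffRing K) : K) : PadicAlgCl p)‖ ^ e = (p : ℝ)⁻¹ := by
    have h : ‖((((p : ℕ) : padicCoeffRing K) : K) : PadicAlgCl p)‖ =
        ‖(((vu * ϖ ^ e : padicCoeffRing K) : K) : PadicAlgCl p)‖ := by rw [hpe]
    push_cast at h
    rw [norm_mul, norm_pow, (isUnit_padicCoeffRing_iff K _).mp vu.isUnit, one_mul, hpA] at h
    exact h.symm
  have he0 : 0 < e := by
    rcases Nat.eq_zero_or_pos e with h | h
    · rw [h, pow_zero] at hπe
      exact absurd hπe (ne_of_gt (inv_lt_one_of_one_lt₀ hp1R))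
    · exact h
  -- the roots and `u₀` are integral
  have hiW := map_integralModelInt W'
  have hintA : ∀ x : ℤ, ‖φA (x : ℚ)‖ ≤ 1 := fun x ↦ by
    rw [← hQA, hnormQ, Rat.cast_intCast]; exact Padic.norm_int_le_one x
  have hb₂ : W'.b₂ = ((integralModelInt W').b₂ : ℚ) := by
    have h := (integralModelInt W').map_b₂ (Int.castRingHom ℚ)
    rw [hiW, eq_intCast] at h
    exact h
  have hb₄ : W'.b₄ = ((integralModelInt W').b₄ : ℚ) := by
    have h := (integralModelInt W').map_b₄ (Int.castRingHom ℚ)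
    rw [hiW, eq_intCast] at h
    exact h
  have hb₆ : W'.b₆ = ((integralModelInt W').b₆ : ℚ) := by
    have h := (integralModelInt W').map_b₆ (Int.castRingHom ℚ)
    rw [hiW, eq_intCast] at h
    exact h
  have hnb₂ : ‖φA W'.b₂‖ ≤ 1 := by rw [hb₂]; exact hintA _
  have hnb₄ : ‖φA (2 * W'.b₄)‖ ≤ 1 := by
    rw [hb₄, show (2 * ((integralModelInt W').b₄ : ℚ)) = ((2 * (integralModelInt W').b₄ : ℤ) : ℚ) by
      push_cast; ring]
    exact hintA _
  have hnb₆ : ‖φA W'.b₆‖ ≤ 1 := by rw [hb₆]; exact hintA _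
  have hne : ∀ e' ∈ ({e₁, e₂, e₃} : Multiset (PadicAlgCl p)), ‖e'‖ ≤ 1 := fun e' he' ↦
    norm_le_one_of_twoTorsion_cubic_root h4A hnb₂ hnb₄ hnb₆ (hroot e' he')
  have hne₁ : ‖e₁‖ ≤ 1 := hne e₁ (by simp)
  have hne₂ : ‖e₂‖ ≤ 1 := hne e₂ (by simp)
  have hne₃ : ‖e₃‖ ≤ 1 := hne e₃ (by simp)
  have hnu₀ : ‖u₀‖ ≤ 1 := by
    have h2 : ‖u₀‖ ^ 2 ≤ 1 := by
      rw [← norm_pow, hu₀]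
      exact (norm_sub_le_max_of_isUltrametricDist _ _).trans (max_le hne₂ hne₁)
    exact (pow_le_one_iff_of_nonneg (norm_nonneg _) two_ne_zero).mp h2
  set d : K := u' with hd
  have hdA : ((d : K) : PadicAlgCl p) = u₀ := rfl
  have hdle : ‖((d : K) : PadicAlgCl p)‖ ≤ 1 := by rw [hdA]; exact hnu₀
  set dO : padicCoeffRing K := ⟨d, (mem_padicCoeffRing_iff K d).mpr hdle⟩ with hdO
  have hdO0 : dO ≠ 0 := fun h ↦ hu'0 (congrArg Subtype.val h)
  obtain ⟨k, w, hdk⟩ := IsDiscreteValuationRing.eq_unit_mul_pow_irreducible hdO0 hϖ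
  have hw0K : ((w : padicCoeffRing K) : K) ≠ 0 := fun h ↦ (w.isUnit.ne_zero) (Subtype.ext h)
  have hdK : d = ((w : padicCoeffRing K) : K) * ((ϖ : padicCoeffRing K) : K) ^ k := by
    have h : ((dO : padicCoeffRing K) : K) = (((w * ϖ ^ k : padicCoeffRing K)) : K) := by rw [hdk]
    push_cast at h
    exact h
  have hwA1 : ‖(((w : padicCoeffRing K) : K) : PadicAlgCl p)‖ = 1 :=
    (isUnit_padicCoeffRing_iff K _).mp w.isUnit
  /- Step 6: `r, s, t, λ ∈ O` and the `O`-curve `V'' = (w⁻¹, 0, 0, 0) • Legendre`. -/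
  have ha₁ : W'.a₁ = ((integralModelInt W').a₁ : ℚ) := by
    have h := congrArg WeierstrassCurve.a₁ hiW
    simp only [WeierstrassCurve.map, eq_intCast] at h
    exact h.symm
  have ha₃ : W'.a₃ = ((integralModelInt W').a₃ : ℚ) := by
    have h := congrArg WeierstrassCurve.a₃ hiW
    simp only [WeierstrassCurve.map, eq_intCast] at h
    exact h.symm
  have hna₁ : ‖((W'K.a₁ : K) : PadicAlgCl p)‖ ≤ 1 := by
    change ‖((φQ W'.a₁ : K) : PadicAlgCl p)‖ ≤ 1
    rw [hQA, ha₁]; exact hintA _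
  have hna₃ : ‖((W'K.a₃ : K) : PadicAlgCl p)‖ ≤ 1 := by
    change ‖((φQ W'.a₃ : K) : PadicAlgCl p)‖ ≤ 1
    rw [hQA, ha₃]; exact hintA _
  have hr : ‖((e₁K : K) : PadicAlgCl p)‖ ≤ 1 := hne₁
  have hK2n : ‖((2 : K) : PadicAlgCl p)‖ = 1 := by rw [hK2]; exact hp2A
  have hs : ‖((-W'K.a₁ / 2 : K) : PadicAlgCl p)‖ ≤ 1 := by
    have e1 : ((-W'K.a₁ / 2 : K) : PadicAlgCl p) =
        -((W'K.a₁ : K) : PadicAlgCl p) / ((2 : K) : PadicAlgCl p) := by push_cast; ring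
    rw [e1, norm_div, norm_neg, hK2n, div_one]
    exact hna₁
  have ht : ‖((-(W'K.a₃ + e₁K * W'K.a₁) / 2 : K) : PadicAlgCl p)‖ ≤ 1 := by
    have e1 : ((-(W'K.a₃ + e₁K * W'K.a₁) / 2 : K) : PadicAlgCl p) =
        -(((W'K.a₃ : K) : PadicAlgCl p) + ((e₁K : K) : PadicAlgCl p) * ((W'K.a₁ : K) : PadicAlgCl p)) /
          ((2 : K) : PadicAlgCl p) := by push_cast; ring
    rw [e1, norm_div, norm_neg, hK2n, div_one]
    refine (IsUltrametricDist.norm_add_le_max _ _).trans (max_le hna₃ ?_)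
    rw [norm_mul]
    exact mul_le_one₀ hne₁ (norm_nonneg _) hna₁
  set rO : padicCoeffRing K := ⟨e₁K, (mem_padicCoeffRing_iff K _).mpr hr⟩ with hrO
  set sO : padicCoeffRing K := ⟨-W'K.a₁ / 2, (mem_padicCoeffRing_iff K _).mpr hs⟩ with hsO
  set tO : padicCoeffRing K := ⟨-(W'K.a₃ + e₁K * W'K.a₁) / 2, (mem_padicCoeffRing_iff K _).mpr ht⟩
    with htO
  set lamO : padicCoeffRing K := ⟨lam, (mem_padicCoeffRing_iff K _).mpr hlam1.le⟩ with hlamO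
  set wO : padicCoeffRing K := (w : padicCoeffRing K) with hwO
  set V'' : WeierstrassCurve (padicCoeffRing K) :=
    ⟨0, -(1 + lamO) * wO ^ 2, 0, lamO * wO ^ 4, 0⟩ with hV''
  set πu : Kˣ := Units.mk0 ((ϖ : padicCoeffRing K) : K) hϖ0 with hπu
  set wK : Kˣ := Units.mk0 ((w : padicCoeffRing K) : K) hw0K with hwK
  have hVar : (⟨πu ^ k, (rO : K), (sO : K), (tO : K)⟩ : VariableChange K) = ⟨wK⁻¹, 0, 0, 0⟩ * D := by
    rw [VariableChange.mul_def]
    congr 1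
    · apply Units.ext
      rw [Units.val_pow_eq_pow_val, Units.val_mul, Units.val_inv_eq_inv_val, hπu, hwK, Units.val_mk0,
        Units.val_mk0, hDdef, Units.val_mk0, ← hd, hdK, ← mul_assoc, inv_mul_cancel₀ hw0K, one_mul]
    · simp [hrO, hDdef]
    · simp [hsO, hDdef]
    · simp [htO, hDdef]
  have halgO : ∀ y : padicCoeffRing K, algebraMap (padicCoeffRing K) K y = (y : K) := fun y ↦ rfl
  have hlamK : (lamO : K) = lam := rfl
  have hV''K : V''.map (algebraMap (padicCoeffRing K) K) =
      (⟨πu ^ k, (rO : K), (sO : K), (tO : K)⟩ : VariableChange K) • W'K := by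
    rw [hVar, mul_smul, hD]
    ext
    · simp only [hV'', WeierstrassCurve.map, halgO, hL, variableChange_a₁, hwK, inv_inv,
        Units.val_mk0, mul_zero, add_zero]
      push_cast; ring
    · simp only [hV'', WeierstrassCurve.map, halgO, hL, variableChange_a₂, hwK, inv_inv,
        Units.val_mk0, mul_zero, add_zero, sub_zero, hwO]
      push_cast
      rw [hlamK]; ring
    · simp only [hV'', WeierstrassCurve.map, halgO, hL, variableChange_a₃, hwK, inv_inv,
        Units.val_mk0, mul_zero, add_zero]
      push_cast; ring
    · simp only [hV'', WeierstrassCurve.map, halgO, hL, variableChange_a₄, hwK, inv_inv,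
        Units.val_mk0, mul_zero, add_zero, sub_zero, zero_mul, hwO]
      push_cast
      rw [hlamK]; ring
    · simp only [hV'', WeierstrassCurve.map, halgO, hL, variableChange_a₆, hwK, inv_inv,
        Units.val_mk0, mul_zero, add_zero, sub_zero, zero_mul]
      push_cast; ring
  /- Step 7: `Δ(V'') = 16λ²(λ − 1)²w¹²` is a unit. -/
  have hΔV : V''.Δ = 16 * lamO ^ 2 * (lamO - 1) ^ 2 * wO ^ 12 := by
    simp only [hV'', WeierstrassCurve.Δ, WeierstrassCurve.b₂, WeierstrassCurve.b₄,
      WeierstrassCurve.b₆, WeierstrassCurve.b₈]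
    ring
  have h16O : ‖((((16 : padicCoeffRing K) : padicCoeffRing K) : K) : PadicAlgCl p)‖ = 1 := by
    have e1 : ((((16 : padicCoeffRing K) : padicCoeffRing K) : K) : PadicAlgCl p) =
        ((φQ 16 : K) : PadicAlgCl p) := by
      rw [show (16 : padicCoeffRing K) = (1 + 1) ^ 4 by norm_num, map_ofNat,
        show (16 : K) = (1 + 1) ^ 4 by norm_num]
      push_cast; ring
    rw [e1, hnormQ, h16Q]
  have hwOA : ‖(((wO : padicCoeffRing K) : K) : PadicAlgCl p)‖ = 1 := hwA1
  have hlamOA : ‖(((lamO : padicCoeffRing K) : K) : PadicAlgCl p)‖ = 1 := hlam1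
  have hlamOA' : ‖(((lamO : padicCoeffRing K) : K) : PadicAlgCl p) - 1‖ = 1 := hlam1'
  have hunit : IsUnit V''.Δ := by
    rw [isUnit_padicCoeffRing_iff K, hΔV]
    have e1 : ((((16 * lamO ^ 2 * (lamO - 1) ^ 2 * wO ^ 12 : padicCoeffRing K)) : K) : PadicAlgCl p) =
        ((((16 : padicCoeffRing K) : padicCoeffRing K) : K) : PadicAlgCl p) *
          (((lamO : padicCoeffRing K) : K) : PadicAlgCl p) ^ 2 *
          ((((lamO : padicCoeffRing K) : K) : PadicAlgCl p) - 1) ^ 2 *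
          (((wO : padicCoeffRing K) : K) : PadicAlgCl p) ^ 12 := by
      push_cast; ring
    rw [e1, norm_mul, norm_mul, norm_mul, norm_pow, norm_pow, norm_pow, h16O, hlamOA, hlamOA', hwOA]
    norm_num
  /- Step 8: `12k = ve`. -/
  have hke : 12 * k = v * e := by
    have hΔK : W'K.Δ = ((πu ^ k : Kˣ) : K) ^ 12 * (V''.map (algebraMap (padicCoeffRing K) K)).Δ := by
      rw [hV''K, variableChange_Δ, ← mul_assoc, ← mul_pow, Units.mul_inv, one_pow, one_mul]
    rw [WeierstrassCurve.map_Δ, WeierstrassCurve.map_Δ, halgO, Units.val_pow_eq_pow_val, hπu,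
      Units.val_mk0] at hΔK
    have h : ‖((φQ W'.Δ : K) : PadicAlgCl p)‖ =
        ‖((((((ϖ : padicCoeffRing K) : K) ^ k) ^ 12 * ((V''.Δ : padicCoeffRing K) : K) : K)) :
          PadicAlgCl p)‖ := by rw [hΔK]
    rw [hnormQ, hv] at h
    have e1 : ((((((ϖ : padicCoeffRing K) : K) ^ k) ^ 12 * ((V''.Δ : padicCoeffRing K) : K) : K)) :
        PadicAlgCl p) = (((ϖ : padicCoeffRing K) : K) : PadicAlgCl p) ^ (k * 12) *
          (((V''.Δ : padicCoeffRing K) : K) : PadicAlgCl p) := by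
      push_cast; ring
    rw [e1, norm_mul, (isUnit_padicCoeffRing_iff K _).mp hunit, mul_one, norm_pow, ← hπe,
      ← pow_mul] at h
    have h' := pow_right_injective₀ hϖpos hϖlt.ne h
    linarith
  refine ⟨K, hKfd, πu, e, k, rO, sO, tO, V'', ?_, he0, hke, hV''K, hunit⟩
  rw [hπu, Units.val_mk0]
  exact hπe

end Twist


/-! ### `‖q‖₃ ≤ 1` at the additive prime `3`, and `q ∈ ℤ` away from additive `2` -/

section Three

open scoped IntermediateField
open Literature.NumberTheory.GaloisRepresentations IsLocalRing
open Literature.NumberTheory.EllipticCurves.ModularForms Literature.NumberTheory.Automorphic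
open scoped MatrixGroups ModularForm
open CongruenceSubgroup PowerSeries

/-- `‖Δ(W')‖_p = p^{−v_p(Δ_min)}`. [folklore] -/
theorem norm_Δ_eq_inv_pow_padicValInt (W' : WeierstrassCurve ℚ) [W'.IsElliptic]
    [W'.IsGloballyMinimal] {p : ℕ} [hp : Fact p.Prime] :
    ‖((W'.Δ : ℚ) : ℚ_[p])‖ = ((p : ℝ)⁻¹) ^ padicValInt p (minimalDiscriminantInt W') := by
  have h0 : ((minimalDiscriminantInt W' : ℤ) : ℚ) ≠ 0 := by
    rw [cast_minimalDiscriminantInt]; exact W'.isUnit_Δ.ne_zero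
  rw [← cast_minimalDiscriminantInt, Padic.eq_padicNorm, padicNorm.eq_zpow_of_nonzero h0,
    padicValRat.of_int, zpow_neg, zpow_natCast, inv_pow]
  push_cast
  rfl

/-- **`‖q‖₃ ≤ 1` at an additive prime `3` of potentially good reduction** (`‖j‖₃ ≤ 1`): the
Legendre twist (`exists_legendreTwist_of_norm_j_le_one`, `12k = e·v₃(Δ_min)`), the Kraus bound
`v₃(Δ_min) ≤ 13` (`v₃(Δ_min) ≥ 14` and `‖j‖ ≤ 1` would give `3⁵ ∣ c₄`, against
`not_pow_dvd_c₄_minimalDiscriminantInt_three`), hence `8k < 9e`, and the good-twist ender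
`…_of_goodTwist_three`. [cite: EdixhovenManin1991, Prop. 2] [cite: SilvermanAEC2009, VII.5.4, VII.5.5, Ex. 7.1] -/
theorem padicNorm_le_one_of_neronLattice_eq_smul_periodLattice_of_norm_j_le_one_three
    {N : ℕ} [NeZero N]
    {W' : WeierstrassCurve ℚ} [W'.IsElliptic] [W'.IsGloballyMinimal] {f : CuspForm (Gamma0 N) 2}
    {L' : PeriodPair} (hf : IsNewformOf W' f) (hL' : IsNeronLatticeOf (W'.baseChange ℂ) L')
    {q : ℚ} (hq : ∀ z ∈ periodLattice f, (q : ℂ) * z ∈ L'.lattice)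
    (hq' : ∀ z ∈ L'.lattice, ∃ w ∈ periodLattice f, z = q * w)
    [hp : Fact (Nat.Prime 3)]
    (hΔ : (3 : ℤ) ∣ minimalDiscriminantInt W') (hc₄ : (3 : ℤ) ∣ (integralModelInt W').c₄)
    (hj : ‖((W'.j : ℚ) : ℚ_[3])‖ ≤ 1) : ‖(q : ℚ_[3])‖ ≤ 1 := by
  set v := padicValInt 3 (minimalDiscriminantInt W') with hv_def
  have hv := norm_Δ_eq_inv_pow_padicValInt W' (p := 3)
  obtain ⟨K, hK, πu, e, k, r, s, t, V'', hπe, he, hke, hV'', hunit⟩ :=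
    exists_legendreTwist_of_norm_j_le_one (p := 3) (by norm_num) W' hj hv
  haveI := hK
  refine padicNorm_le_one_of_neronLattice_eq_smul_periodLattice_of_goodTwist_three hf hL' hq hq'
    hΔ hc₄ K πu hπe r s t V'' hV'' hunit ?_
  -- `v ≤ 13` by Kraus
  have hv13 : v ≤ 13 := by
    by_contra hcon
    have hv14 : 14 ≤ v := by omega
    apply not_pow_dvd_c₄_minimalDiscriminantInt_three W'
    refine ⟨?_, (padicValInt_dvd_iff 14 _).mpr (Or.inr hv14)⟩
    have hjΔ : ((W'.j : ℚ) : ℚ_[3]) * ((W'.Δ : ℚ) : ℚ_[3]) = ((W'.c₄ : ℚ) : ℚ_[3]) ^ 3 := by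
      exact_mod_cast WeierstrassCurve.j_mul_Δ_eq_c₄_pow W'
    have hn3 : ‖((W'.c₄ : ℚ) : ℚ_[3])‖ ^ 3 ≤ ((3 : ℝ)⁻¹) ^ 14 := by
      rw [← norm_pow, ← hjΔ, norm_mul, hv]
      calc ‖((W'.j : ℚ) : ℚ_[3])‖ * ((3 : ℕ) : ℝ)⁻¹ ^ v ≤ 1 * ((3 : ℕ) : ℝ)⁻¹ ^ v := by gcongr
        _ = ((3 : ℕ) : ℝ)⁻¹ ^ v := one_mul _
        _ ≤ ((3 : ℕ) : ℝ)⁻¹ ^ 14 := pow_le_pow_of_le_one (by positivity)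
            (inv_le_one_of_one_le₀ (by norm_num)) hv14
        _ = (3 : ℝ)⁻¹ ^ 14 := by norm_num
    by_cases hc₄0 : (integralModelInt W').c₄ = 0
    · rw [hc₄0]; exact dvd_zero _
    have hm := norm_c₄_eq_inv_pow_padicValInt W' (p := 3) hc₄0
    rw [hm, ← pow_mul] at hn3
    have h3m : 14 ≤ padicValInt 3 (integralModelInt W').c₄ * 3 := by
      by_contra h'
      rw [not_le] at h'
      have hlt : ((3 : ℕ) : ℝ)⁻¹ ^ 14 < ((3 : ℕ) : ℝ)⁻¹ ^ (padicValInt 3 (integralModelInt W').c₄ * 3) :=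
        (pow_lt_pow_iff_right_of_lt_one₀ (by positivity) (inv_lt_one_of_one_lt₀ (by norm_num))).mpr h'
      have : ((3 : ℕ) : ℝ)⁻¹ ^ 14 = (3 : ℝ)⁻¹ ^ 14 := by norm_num
      linarith
    refine (padicValInt_dvd_iff 5 _).mpr (Or.inr ?_)
    generalize padicValInt 3 (integralModelInt W').c₄ = m at h3m ⊢
    omega
  -- `96k = 8ve ≤ 104e < 108e`
  have h1 : 8 * (12 * k) ≤ 8 * (13 * e) := by rw [hke]; exact Nat.mul_le_mul_left _ (Nat.mul_le_mul_right _ hv13)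
  omega

/-- **`‖q‖₃ ≤ 1` at an ADDITIVE prime `3`, unconditionally** (potentially good: above;
potentially multiplicative: `…_of_one_lt_norm_j_three` of `ManinConstantPotMultiplicativeProofs`).
[cite: EdixhovenManin1991, Prop. 2] -/
theorem padicNorm_le_one_of_neronLattice_eq_smul_periodLattice_of_additive_three
    {N : ℕ} [NeZero N]
    {W' : WeierstrassCurve ℚ} [W'.IsElliptic] [W'.IsGloballyMinimal] {f : CuspForm (Gamma0 N) 2}
    {L' : PeriodPair} (hf : IsNewformOf W' f) (hL' : IsNeronLatticeOf (W'.baseChange ℂ) L')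
    {q : ℚ} (hq : ∀ z ∈ periodLattice f, (q : ℂ) * z ∈ L'.lattice)
    (hq' : ∀ z ∈ L'.lattice, ∃ w ∈ periodLattice f, z = q * w)
    [hp : Fact (Nat.Prime 3)]
    (hΔ : (3 : ℤ) ∣ minimalDiscriminantInt W') (hc₄ : (3 : ℤ) ∣ (integralModelInt W').c₄) :
    ‖(q : ℚ_[3])‖ ≤ 1 := by
  rcases le_or_gt ‖((W'.j : ℚ) : ℚ_[3])‖ 1 with hj | hj
  · exact padicNorm_le_one_of_neronLattice_eq_smul_periodLattice_of_norm_j_le_one_three hf hL' hq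
      hq' hΔ hc₄ hj
  · exact padicNorm_le_one_of_neronLattice_eq_smul_periodLattice_of_one_lt_norm_j_three hf hL' hq
      hq' hΔ hc₄ hj

/-- **`‖q‖₃ ≤ 1` always.** [cite: EdixhovenManin1991, Prop. 2] -/
theorem padicNorm_three_le_one_of_neronLattice_eq_smul_periodLattice
    {N : ℕ} [NeZero N]
    {W' : WeierstrassCurve ℚ} [W'.IsElliptic] [W'.IsGloballyMinimal] {f : CuspForm (Gamma0 N) 2}
    {L' : PeriodPair} (hf : IsNewformOf W' f) (hL' : IsNeronLatticeOf (W'.baseChange ℂ) L')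
    {q : ℚ} (hq : ∀ z ∈ periodLattice f, (q : ℂ) * z ∈ L'.lattice)
    (hq' : ∀ z ∈ L'.lattice, ∃ w ∈ periodLattice f, z = q * w)
    [hp : Fact (Nat.Prime 3)] : ‖(q : ℚ_[3])‖ ≤ 1 := by
  by_cases hadd : ((3 : ℕ) : ℤ) ∣ minimalDiscriminantInt W' ∧ ((3 : ℕ) : ℤ) ∣ (integralModelInt W').c₄
  · exact padicNorm_le_one_of_neronLattice_eq_smul_periodLattice_of_additive_three hf hL' hq hq'
      (by exact_mod_cast hadd.1) (by exact_mod_cast hadd.2)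
  · exact padicNorm_le_one_of_neronLattice_eq_smul_periodLattice_of_not_additive' hf hL' hq hq' hadd

/-- **Edixhoven's conclusion `q ∈ ℤ` for every `W'` whose reduction at `2` is not additive**
(`v₂(N) ≤ 1`): the prime `3` is now unconditional. [cite: EdixhovenManin1991, Prop. 2] -/
theorem int_of_neronLattice_eq_smul_periodLattice_of_not_additive_two {N : ℕ} [NeZero N]
    {W' : WeierstrassCurve ℚ} [W'.IsElliptic] [W'.IsGloballyMinimal] {f : CuspForm (Gamma0 N) 2}
    {L' : PeriodPair} (hf : IsNewformOf W' f) (hL' : IsNeronLatticeOf (W'.baseChange ℂ) L')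
    {q : ℚ} (hq : ∀ z ∈ periodLattice f, (q : ℂ) * z ∈ L'.lattice)
    (hq' : ∀ z ∈ L'.lattice, ∃ w ∈ periodLattice f, z = q * w)
    (h2 : ¬ ((2 : ℤ) ∣ minimalDiscriminantInt W' ∧ (2 : ℤ) ∣ (integralModelInt W').c₄)) :
    ∃ k : ℤ, (k : ℚ) = q := by
  have hden : q.den = 1 := by
    by_contra hne
    obtain ⟨p, hp, hpq⟩ := Nat.exists_prime_and_dvd hne
    obtain ⟨h23, hΔ, hc₄⟩ :=
      eq_two_or_eq_three_and_additive_of_dvd_den_of_neronLattice_eq_smul_periodLattice hf hL' hq hq' hp hpq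
    rcases h23 with rfl | rfl
    · exact h2 ⟨by exact_mod_cast hΔ, by exact_mod_cast hc₄⟩
    · -- `3 ∣ den q` contradicts `‖q‖₃ ≤ 1`
      haveI : Fact (Nat.Prime 3) := ⟨Nat.prime_three⟩
      have hle := padicNorm_three_le_one_of_neronLattice_eq_smul_periodLattice hf hL' hq hq'
      have hqden : ‖((q.den : ℤ) : ℚ_[3])‖ < 1 :=
        Padic.norm_intCast_lt_one_iff.mpr (Int.natCast_dvd_natCast.mpr hpq)
      have hnum : ‖((q.num : ℤ) : ℚ_[3])‖ = 1 := by
        refine le_antisymm (Padic.norm_int_le_one _) (not_lt.mp fun h ↦ ?_)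
        have hpn : 3 ∣ q.num.natAbs := Int.natCast_dvd.mp (Padic.norm_intCast_lt_one_iff.mp h)
        have h1 : 3 ∣ 1 := by
          have h' := Nat.dvd_gcd hpn hpq
          rwa [Nat.Coprime.gcd_eq_one q.reduced] at h'
        omega
      have hq'' : (q : ℚ_[3]) = ((q.num : ℤ) : ℚ_[3]) / ((q.den : ℤ) : ℚ_[3]) := by
        rw [Int.cast_natCast, ← Rat.cast_intCast, ← Rat.cast_natCast, ← Rat.cast_div, Rat.num_div_den]
      have hden0 : 0 < ‖((q.den : ℤ) : ℚ_[3])‖ := by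
        rw [norm_pos_iff, Int.cast_natCast, Nat.cast_ne_zero]
        exact q.den_nz
      have hlt : 1 < ‖(q : ℚ_[3])‖ := by
        rw [hq'', norm_div, hnum, one_div, one_lt_inv₀ hden0]
        exact hqden
      exact absurd hle (not_le.mpr hlt)
  exact ⟨q.num, Rat.coe_int_num_of_den_eq_one hden⟩

/-- **The fact `edixhoven_int_of_neronLattice_eq_smul_periodLattice` reduces to its local
statement at an additive prime `2`:** if `‖q‖₂ ≤ 1` for every datum of the fact whose curve is
additive at `2`, the fact holds. [cite: EdixhovenManin1991, Prop. 2] -/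
theorem edixhoven_int_of_neronLattice_eq_smul_periodLattice_of_additive_two
    (h2 : ∀ {N : ℕ} [NeZero N] {W' : WeierstrassCurve ℚ} [W'.IsElliptic] [W'.IsGloballyMinimal]
      {f : CuspForm (Gamma0 N) 2} {L' : PeriodPair}, IsNewformOf W' f →
      IsNeronLatticeOf (W'.baseChange ℂ) L' → ∀ q : ℚ,
      (∀ z ∈ periodLattice f, (q : ℂ) * z ∈ L'.lattice) →
      (∀ z ∈ L'.lattice, ∃ w ∈ periodLattice f, z = q * w) →
      (2 : ℤ) ∣ minimalDiscriminantInt W' → (2 : ℤ) ∣ (integralModelInt W').c₄ →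
      ‖(q : ℚ_[2])‖ ≤ 1) :
    edixhoven_int_of_neronLattice_eq_smul_periodLattice := by
  intro N _ W' _ _ f L' hf hL' q hq hq'
  have hden : q.den = 1 := by
    by_contra hne
    obtain ⟨p, hp, hpq⟩ := Nat.exists_prime_and_dvd hne
    obtain ⟨h23, hΔ, hc₄⟩ :=
      eq_two_or_eq_three_and_additive_of_dvd_den_of_neronLattice_eq_smul_periodLattice hf hL' hq hq' hp hpq
    haveI := Fact.mk hp
    have hle : ‖(q : ℚ_[p])‖ ≤ 1 := by
      rcases h23 with rfl | rfl
      · exact h2 hf hL' q hq hq' (by exact_mod_cast hΔ) (by exact_mod_cast hc₄)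
      · exact padicNorm_three_le_one_of_neronLattice_eq_smul_periodLattice hf hL' hq hq'
    have hqden : ‖((q.den : ℤ) : ℚ_[p])‖ < 1 :=
      Padic.norm_intCast_lt_one_iff.mpr (Int.natCast_dvd_natCast.mpr hpq)
    have hnum : ‖((q.num : ℤ) : ℚ_[p])‖ = 1 := by
      refine le_antisymm (Padic.norm_int_le_one _) (not_lt.mp fun h ↦ ?_)
      have hpn : p ∣ q.num.natAbs := Int.natCast_dvd.mp (Padic.norm_intCast_lt_one_iff.mp h)
      have h1 : p ∣ 1 := by
        have h' := Nat.dvd_gcd hpn hpq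
        rwa [Nat.Coprime.gcd_eq_one q.reduced] at h'
      exact hp.ne_one (Nat.dvd_one.mp h1)
    have hq'' : (q : ℚ_[p]) = ((q.num : ℤ) : ℚ_[p]) / ((q.den : ℤ) : ℚ_[p]) := by
      rw [Int.cast_natCast, ← Rat.cast_intCast, ← Rat.cast_natCast, ← Rat.cast_div, Rat.num_div_den]
    have hden0 : 0 < ‖((q.den : ℤ) : ℚ_[p])‖ := by
      rw [norm_pos_iff, Int.cast_natCast, Nat.cast_ne_zero]
      exact q.den_nz
    have hlt : 1 < ‖(q : ℚ_[p])‖ := by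
      rw [hq'', norm_div, hnum, one_div, one_lt_inv₀ hden0]
      exact hqden
    exact absurd hle (not_le.mpr hlt)
  exact ⟨q.num, Rat.coe_int_num_of_den_eq_one hden⟩

end Three

end Literature.NumberTheory.EllipticCurves
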